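import Summits.QuantumFields.YangMills.Theorems.LuscherReductionTwistedTraceScalingBOStiffFlatCoordsDefs
import Summits.QuantumFields.YangMills.Theorems.LuscherReductionTwistedTraceScalingVacuumHodge
import Summits.QuantumFields.YangMills.Theorems.LuscherReductionTwistedTraceScalingBOShellCoercive
import Summits.QuantumFields.YangMills.Theorems.LuscherReductionTwistedTraceScalingInnerKineticSplit
import Summits.QuantumFields.YangMills.Theorems.LuscherReductionTwistedTraceScalingBTTubeMagnetic
import Literature.Analysis.OperatorTheory.GaussianTransferKernelFrame
import HarnessLib

/-!
# (B-ST) the DICTIONARY of the profile-adapted flat coordinates `flatVec β : (StiffIdx β → ℝ) × gaugeModes L →ₗ LinkSpace L`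
# (lane A of S-BASE, crux `TwistedTraceScaling` stmt-QuantumFields-20203, C4-CORE, the (B-ST) pen; `pub/ym-fleet/ym-luscher-20007-p1/HANDOFF-g22.md` §PLAN TO CLOSE hflat (1))

For the objects of ✓`…BOStiffFlatCoordsDefs` (eigenframe `(E_i, α_i)` of `(β/2)·H`, `c_i = √(α_i²+2α_iβ)`, `γ_i = √(π/c_i)`, `v = flatVec β (y,z) = Σ_i γ_i y_i E_i + z`):
* §1 the frame: `α_i ≥ 0`; `(β/2)H E_i = α_i E_i`; stiff modes (`α_i ≠ 0`) lie in `stiffSpace L = (constModes ⊔ gaugeModes)ᗮ` (so `⟪E_i, z⟫ = 0` for gauge `z`), zero modes in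
  `ker H = constModes ⊔ gaugeModes` (✓`ker_covCurl_one_eq`); on stiff modes `c_i > 0`, `γ_i > 0`, and the Mehler data `ã_i = α_iγ_i²`, `b̃_i = βγ_i²` satisfy
  ★ `flatA_sq_add : ã_i² + 2ã_ib̃_i = π²`;
* §2 coordinates: `⟪E_j, v⟫ = γ_j y_j` on stiff `j`, the stiff part `s = Σ γ_i y_i E_i ∈ stiffSpace`, ★ `starProjection_gaugeModes_flatVec : P_Γ v = z`, ★ `flatVec_sub_starProjection : v − P_Γ v = s`,
  ★ `norm_stiffPart_sq : ‖s‖² = Σ γ_i² y_i²`, `norm_flatVec_sq : ‖v‖² = Σγ_i²y_i² + ‖z‖²`, `flatVec_injective`;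
* §3 ★★ `stiffGaussExp_flatVec : q_β(v) = π·Σ y_i²`, ★★ `inner_hessian_flatVec : ⟪v, (β/2)H v⟫ = Σ ã_i y_i²`;
* §4 ★★ `flatVec_mem_orthogonal_constModes` and ★★ `range_flatMap : Set.range (flatMap β) = balancedSet L` (every balanced `x̂` is its stiff part plus `P_Γ x̂`, the zero-mode part being
  `P_{const ⊔ gauge} x̂ = P_Γ x̂` for `x̂ ⊥ const`), `flatMap_injective`, `linkEmbed_flatMap : linkEmbed (flatMap β p) = flatVec β p`.
HONEST FRAMING: finite-dimensional linear algebra for a stub of a child of the CONDITIONAL route R2b1; (B-ST) OPEN; C4-CORE OPEN; not infinite volume, not a gap, not Clay.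
-/

set_option autoImplicit false

noncomputable section

open scoped BigOperators RealInnerProductSpace
open Literature.MathematicalPhysics.QuantumFieldTheory Literature.MathematicalPhysics.QuantumLattice

namespace Summit.QuantumFields.YangMills.Theorems.FemtoTransferGap.TwoLattice.ConstTube

open Summit.QuantumFields.YangMills.Theorems.FemtoTransferGap
open TwoLattice TwoLattice.Stiff TwoLattice.Cov TwoLattice.GnChart TwoLattice.Toron

variable {L : ℕ} [NeZero L]

/-! ## §1 The frame -/
set_option maxHeartbeats 400000 in
/-- The frame is the eigenbasis: `((β/2)·H) E_i = α_i E_i`. [folklore] -/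
theorem apply_eigVec (β : ℝ) (i : Fin (Fintype.card (Edge 3 L × Fin 3))) :
    ((β / 2) • stiffHessian L) (eigVec L β i) = eigVal L β i • eigVec L β i := by
  have h := (isSymmetric_smul_stiffHessian (L := L) (β / 2)).apply_eigenvectorBasis finrank_euclideanSpace i
  simpa [eigVec, eigVal] using h

/-- The frame is orthonormal. [folklore] -/
theorem eigVec_orthonormal (β : ℝ) : Orthonormal ℝ (eigVec L β) :=
  ((isSymmetric_smul_stiffHessian (L := L) (β / 2)).eigenvectorBasis finrank_euclideanSpace).orthonormal

/-- `α_i ≥ 0` for `β ≥ 0`. [folklore] -/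
theorem eigVal_nonneg {β : ℝ} (hβ : 0 ≤ β) (i : Fin (Fintype.card (Edge 3 L × Fin 3))) : 0 ≤ eigVal L β i :=
  (isPositive_smul_stiffHessian L (by linarith : 0 ≤ β / 2)).nonneg_eigenvalues finrank_euclideanSpace i

/-- `‖d E_i‖² = (2/β)·α_i`: `⟪E_i, (β/2)H E_i⟫ = α_i`. [folklore] -/
theorem inner_hessian_eigVec (β : ℝ) (i : Fin (Fintype.card (Edge 3 L × Fin 3))) : ⟪eigVec L β i, ((β / 2) • stiffHessian L) (eigVec L β i)⟫ = eigVal L β i := by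
  rw [apply_eigVec, real_inner_smul_right, real_inner_self_eq_norm_sq, (eigVec_orthonormal (L := L) β).1 i]; ring

/-- A zero mode is curl-free, hence in `constModes ⊔ gaugeModes` (`β ≠ 0`). [folklore] -/
theorem eigVec_mem_sup_of_eigVal_eq_zero {β : ℝ} (hβ : β ≠ 0) {i : Fin (Fintype.card (Edge 3 L × Fin 3))} (hi : eigVal L β i = 0) :
    eigVec L β i ∈ constModes L ⊔ gaugeModes L := by
  have h := inner_hessian_eigVec (L := L) β i
  rw [hi, LinearMap.smul_apply, real_inner_smul_right, inner_stiffHessian] at h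
  have hcurl : latCurl L (eigVec L β i) = 0 := by
    have : ‖latCurl L (eigVec L β i)‖ ^ 2 = 0 := by
      have hβ2 : β / 2 ≠ 0 := by intro h0; apply hβ; linarith
      exact (mul_eq_zero.1 h).resolve_left hβ2
    exact norm_eq_zero.1 (pow_eq_zero_iff two_ne_zero |>.1 this)
  rw [← ker_covCurl_one_eq, LinearMap.mem_ker, covCurl_one]; exact hcurl

/-- A stiff mode (`α_i ≠ 0`) lies in `stiffSpace L`. [folklore] -/
theorem eigVec_mem_stiffSpace (β : ℝ) {i : Fin (Fintype.card (Edge 3 L × Fin 3))} (hi : eigVal L β i ≠ 0) : eigVec L β i ∈ stiffSpace L := by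
  -- `stiffSpace = (ker d)ᗮ`; for `w ∈ ker d`: `α_i⟪E_i,w⟫ = ⟪(β/2)H E_i, w⟫ = ⟪E_i, (β/2)H w⟫ = (β/2)⟪d E_i, d w⟫ = 0`
  unfold stiffSpace
  rw [Submodule.mem_orthogonal']
  intro w hw
  rw [LinearMap.mem_ker, covCurl_one] at hw
  have hsym := isSymmetric_smul_stiffHessian (L := L) (β / 2)
  have h1 : ⟪((β / 2) • stiffHessian L) (eigVec L β i), w⟫ = ⟪eigVec L β i, ((β / 2) • stiffHessian L) w⟫ := hsym _ _
  have h2 : ((β / 2) • stiffHessian L) w = 0 := by rw [LinearMap.smul_apply, stiffHessian_eq_zero_of_latCurl L hw, smul_zero]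
  rw [h2, inner_zero_right, apply_eigVec, real_inner_smul_left] at h1
  have h3 : ⟪eigVec L β i, w⟫ = 0 := (mul_eq_zero.1 h1).resolve_left hi
  rw [real_inner_comm] at h3; first | exact h3 | (rw [real_inner_comm]; exact h3)

/-- Stiff modes are orthogonal to gauge modes. [folklore] -/
theorem inner_eigVec_gauge (β : ℝ) {i : Fin (Fintype.card (Edge 3 L × Fin 3))} (hi : eigVal L β i ≠ 0) {z : LinkSpace L} (hz : z ∈ gaugeModes L) :
    ⟪eigVec L β i, z⟫ = 0 := by
  have h := eigVec_mem_stiffSpace (L := L) β hi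
  rw [stiffSpace_eq_orthogonal, Submodule.mem_orthogonal'] at h
  exact h z (Submodule.mem_sup_right hz)

/-- On a stiff mode, `c_i > 0` (`β > 0`). [folklore] -/
theorem stiffCoef_pos {β : ℝ} (hβ : 0 < β) (i : StiffIdx L β) : 0 < stiffCoef L β i.1 := by
  have hα : 0 < eigVal L β i.1 := lt_of_le_of_ne (eigVal_nonneg hβ.le _) (Ne.symm i.2)
  unfold stiffCoef; exact Real.sqrt_pos.2 (by positivity)

/-- `γ_i > 0` and `γ_i² = π/c_i` (`β > 0`). [folklore] -/
theorem flatScale_pos_sq {β : ℝ} (hβ : 0 < β) (i : StiffIdx L β) : 0 < flatScale L β i ∧ flatScale L β i ^ 2 = Real.pi / stiffCoef L β i.1 := by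
  have hc := stiffCoef_pos (L := L) hβ i
  unfold flatScale
  exact ⟨Real.sqrt_pos.2 (div_pos Real.pi_pos hc), Real.sq_sqrt (div_pos Real.pi_pos hc).le⟩

/-- ★ **The rescaled Mehler data are in the normalisation of `…MehlerPoincare`**: `ã_i² + 2ã_ib̃_i = π²`, with `0 < ã_i`, `0 < b̃_i` (`β > 0`). [folklore] -/
theorem flatA_sq_add {β : ℝ} (hβ : 0 < β) (i : StiffIdx L β) :
    0 < flatA L β i ∧ 0 < flatB L β i ∧ flatA L β i ^ 2 + 2 * flatA L β i * flatB L β i = Real.pi ^ 2 := by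
  obtain ⟨hγ, hγ2⟩ := flatScale_pos_sq (L := L) hβ i
  have hα : 0 < eigVal L β i.1 := lt_of_le_of_ne (eigVal_nonneg hβ.le _) (Ne.symm i.2)
  have hc := stiffCoef_pos (L := L) hβ i
  have hc2 : stiffCoef L β i.1 ^ 2 = eigVal L β i.1 ^ 2 + 2 * eigVal L β i.1 * β := by
    unfold stiffCoef; exact Real.sq_sqrt (by positivity)
  refine ⟨by unfold flatA; positivity, by unfold flatB; positivity, ?_⟩
  unfold flatA flatB
  -- `(αγ²)² + 2(αγ²)(βγ²) = γ⁴(α²+2αβ) = γ⁴c² = (π/c)²c² = π²`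
  have : (eigVal L β i.1 * flatScale L β i ^ 2) ^ 2 + 2 * (eigVal L β i.1 * flatScale L β i ^ 2) * (β * flatScale L β i ^ 2) =
      (flatScale L β i ^ 2) ^ 2 * stiffCoef L β i.1 ^ 2 := by rw [hc2]; ring
  rw [this, hγ2]
  field_simp

/-- ★ **The contraction ratio is β-free per mode**: `b̃_i/(ã_i + b̃_i + π) = β/(α_i + β + c_i)`. [folklore] -/
theorem flatRatio_eq {β : ℝ} (hβ : 0 < β) (i : StiffIdx L β) :
    flatB L β i / (flatA L β i + flatB L β i + Real.pi) = β / (eigVal L β i.1 + β + stiffCoef L β i.1) := by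
  obtain ⟨hγ, hγ2⟩ := flatScale_pos_sq (L := L) hβ i
  have hc := stiffCoef_pos (L := L) hβ i
  have hα : 0 ≤ eigVal L β i.1 := eigVal_nonneg hβ.le _
  unfold flatA flatB
  have hπ : Real.pi = stiffCoef L β i.1 * flatScale L β i ^ 2 := by rw [hγ2]; field_simp
  have hden : eigVal L β i.1 * flatScale L β i ^ 2 + β * flatScale L β i ^ 2 + Real.pi = (eigVal L β i.1 + β + stiffCoef L β i.1) * flatScale L β i ^ 2 := by
    rw [hπ]; ring
  rw [hden]
  field_simp

/-! ## §2 Coordinates -/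

/-- The stiff part of `flatVec`. [folklore] -/
theorem flatVec_apply (β : ℝ) (p : (StiffIdx L β → ℝ) × gaugeModes L) :
    flatVec L β p = (∑ i : StiffIdx L β, (flatScale L β i * p.1 i) • eigVec L β i.1) + (p.2 : LinkSpace L) := rfl

/-- The stiff part lies in `stiffSpace`. [folklore] -/
theorem stiffPart_mem_stiffSpace (β : ℝ) (y : StiffIdx L β → ℝ) : (∑ i : StiffIdx L β, (flatScale L β i * y i) • eigVec L β i.1) ∈ stiffSpace L :=
  Submodule.sum_mem _ fun i _ => Submodule.smul_mem _ _ (eigVec_mem_stiffSpace (L := L) β i.2)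

/-- The stiff family `i ↦ E_{i}` on stiff indices is orthonormal. [folklore] -/
theorem eigVec_stiff_orthonormal (β : ℝ) : Orthonormal ℝ (fun i : StiffIdx L β => eigVec L β i.1) :=
  (eigVec_orthonormal (L := L) β).comp _ Subtype.val_injective

/-- Coordinates on a stiff mode: `⟪E_j, v⟫ = γ_j y_j`. [folklore] -/
theorem inner_eigVec_flatVec (β : ℝ) (p : (StiffIdx L β → ℝ) × gaugeModes L) (j : StiffIdx L β) :
    ⟪eigVec L β j.1, flatVec L β p⟫ = flatScale L β j * p.1 j := by
  rw [flatVec_apply, inner_add_right, inner_eigVec_gauge β j.2 p.2.2, add_zero, inner_sum]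
  have horth := eigVec_stiff_orthonormal (L := L) β
  rw [orthonormal_iff_ite] at horth
  simp_rw [real_inner_smul_right, horth]
  simp [Finset.sum_ite_eq, mul_comm]

/-- ★ `P_Γ v = z`. [folklore] -/
theorem starProjection_gaugeModes_flatVec (β : ℝ) (p : (StiffIdx L β → ℝ) × gaugeModes L) :
    (gaugeModes L).starProjection (flatVec L β p) = (p.2 : LinkSpace L) := by
  rw [flatVec_apply, map_add, (Submodule.starProjection_eq_self_iff).2 p.2.2]
  have h0 : (gaugeModes L).starProjection (∑ i : StiffIdx L β, (flatScale L β i * p.1 i) • eigVec L β i.1) = 0 := by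
    rw [Submodule.starProjection_apply_eq_zero_iff]
    have h := stiffPart_mem_stiffSpace (L := L) β p.1
    rw [stiffSpace_eq_orthogonal] at h
    exact Submodule.orthogonal_le (le_sup_right) h
  rw [h0, zero_add]

/-- ★ `v − P_Γ v = ` the stiff part. [folklore] -/
theorem flatVec_sub_starProjection (β : ℝ) (p : (StiffIdx L β → ℝ) × gaugeModes L) :
    flatVec L β p - (gaugeModes L).starProjection (flatVec L β p) = ∑ i : StiffIdx L β, (flatScale L β i * p.1 i) • eigVec L β i.1 := by
  rw [starProjection_gaugeModes_flatVec, flatVec_apply, add_sub_cancel_right]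

/-- ★ `‖Σ a_i E_i‖² = Σ a_i²` on the stiff frame. [folklore] -/
theorem norm_stiffPart_sq (β : ℝ) (a : StiffIdx L β → ℝ) : ‖∑ i : StiffIdx L β, a i • eigVec L β i.1‖ ^ 2 = ∑ i, a i ^ 2 := by
  have h := (eigVec_stiff_orthonormal (L := L) β).inner_sum a a Finset.univ
  rw [← real_inner_self_eq_norm_sq, h]
  exact Finset.sum_congr rfl fun i _ => by rw [conj_trivial, sq]

/-- `‖v‖² = Σ γ_i²y_i² + ‖z‖²` (stiff ⊥ gauge). [folklore] -/
theorem norm_flatVec_sq (β : ℝ) (p : (StiffIdx L β → ℝ) × gaugeModes L) :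
    ‖flatVec L β p‖ ^ 2 = (∑ i, (flatScale L β i * p.1 i) ^ 2) + ‖(p.2 : LinkSpace L)‖ ^ 2 := by
  rw [flatVec_apply]
  have horth : ⟪∑ i : StiffIdx L β, (flatScale L β i * p.1 i) • eigVec L β i.1, (p.2 : LinkSpace L)⟫ = 0 := by
    have h := stiffPart_mem_stiffSpace (L := L) β p.1
    rw [stiffSpace_eq_orthogonal, Submodule.mem_orthogonal'] at h
    exact h _ (Submodule.mem_sup_right p.2.2)
  rw [norm_add_sq_real (∑ i : StiffIdx L β, (flatScale L β i * p.1 i) • eigVec L β i.1) (p.2 : LinkSpace L), horth, mul_zero, add_zero,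
    norm_stiffPart_sq]

/-- `flatVec β` is injective (`β > 0`). [folklore] -/
theorem flatVec_injective {β : ℝ} (hβ : 0 < β) : Function.Injective (flatVec L β) := by
  refine (injective_iff_map_eq_zero _).2 fun p hp => ?_
  have h := norm_flatVec_sq (L := L) β p
  rw [hp, norm_zero, zero_pow two_ne_zero] at h
  have h1 : ∀ i, (flatScale L β i * p.1 i) ^ 2 = 0 := by
    have hs : ∑ i, (flatScale L β i * p.1 i) ^ 2 = 0 := by nlinarith [Finset.sum_nonneg fun i (_ : i ∈ Finset.univ) => sq_nonneg (flatScale L β i * p.1 i), sq_nonneg ‖(p.2 : LinkSpace L)‖]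
    exact fun i => (Finset.sum_eq_zero_iff_of_nonneg fun i _ => sq_nonneg _).1 hs i (Finset.mem_univ i)
  have hz : ‖(p.2 : LinkSpace L)‖ ^ 2 = 0 := by nlinarith [Finset.sum_nonneg fun i (_ : i ∈ Finset.univ) => sq_nonneg (flatScale L β i * p.1 i), sq_nonneg ‖(p.2 : LinkSpace L)‖]
  ext i
  · have := h1 i
    rw [sq_eq_zero_iff, mul_eq_zero] at this
    exact this.resolve_left (flatScale_pos_sq (L := L) hβ i).1.ne'
  · have : (p.2 : LinkSpace L) = 0 := norm_eq_zero.1 (pow_eq_zero_iff two_ne_zero |>.1 hz)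
    exact congrArg (fun v : LinkSpace L => v i) this |>.trans (by simp)

/-! ## §3 The profile exponent and the Hessian form in flat coordinates -/

/-- Coordinates on ALL modes: `⟪E_j, v⟫ = γ_j y_j` if `α_j ≠ 0`, while for `α_j = 0` the coefficient `c_j` vanishes. [folklore] -/
theorem stiffCoef_eq_zero_of_eigVal_eq_zero {β : ℝ} {j : Fin (Fintype.card (Edge 3 L × Fin 3))} (hj : eigVal L β j = 0) : stiffCoef L β j = 0 := by
  unfold stiffCoef; rw [hj]; simp

/-- ★★ **The profile exponent is the standard Gaussian in flat coordinates**: `q_β(flatVec β (y,z)) = π·Σ_i y_i²` (`β > 0`). [cite: Wipf2021, §8.5.2 (8.64)–(8.67)] -/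
theorem stiffGaussExp_flatVec {β : ℝ} (hβ : 0 < β) (p : (StiffIdx L β → ℝ) × gaugeModes L) :
    stiffGaussExp L (β / 2) β (flatVec L β p) = Real.pi * ∑ i, p.1 i ^ 2 := by
  classical
  unfold stiffGaussExp
  -- split the sum over all modes into stiff and zero modes
  have hsplit := (Fintype.sum_subtype_add_sum_subtype (fun j : Fin (Fintype.card (Edge 3 L × Fin 3)) => eigVal L β j ≠ 0)
    (fun j => Real.sqrt (eigVal L β j ^ 2 + 2 * eigVal L β j * β) * ⟪eigVec L β j, flatVec L β p⟫ ^ 2)).symm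
  change ∑ j, Real.sqrt (eigVal L β j ^ 2 + 2 * eigVal L β j * β) * ⟪eigVec L β j, flatVec L β p⟫ ^ 2 = _
  rw [hsplit]
  have hzero : ∑ j : {j : Fin (Fintype.card (Edge 3 L × Fin 3)) // ¬eigVal L β j ≠ 0},
      Real.sqrt (eigVal L β j.1 ^ 2 + 2 * eigVal L β j.1 * β) * ⟪eigVec L β j.1, flatVec L β p⟫ ^ 2 = 0 := by
    refine Finset.sum_eq_zero fun j _ => ?_
    have hj : eigVal L β j.1 = 0 := not_not.1 j.2
    rw [hj]; simp
  rw [hzero, add_zero, Finset.mul_sum]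
  refine Finset.sum_congr rfl fun i _ => ?_
  have hi : (i : StiffIdx L β) = i := rfl
  rw [show ⟪eigVec L β i.1, flatVec L β p⟫ = flatScale L β i * p.1 i from inner_eigVec_flatVec β p i]
  obtain ⟨-, hγ2⟩ := flatScale_pos_sq (L := L) hβ i
  have hc := stiffCoef_pos (L := L) hβ i
  change stiffCoef L β i.1 * (flatScale L β i * p.1 i) ^ 2 = Real.pi * p.1 i ^ 2
  rw [mul_pow, hγ2]; field_simp

/-- ★★ **The Hessian form in flat coordinates**: `⟪v, (β/2)H v⟫ = Σ_i ã_i y_i²` for `v = flatVec β (y,z)`. [cite: HornJohnson2013, Thm 4.1.5] -/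
theorem inner_hessian_flatVec (β : ℝ) (p : (StiffIdx L β → ℝ) × gaugeModes L) :
    ⟪flatVec L β p, ((β / 2) • stiffHessian L) (flatVec L β p)⟫ = ∑ i, flatA L β i * p.1 i ^ 2 := by
  classical
  have h := Literature.Analysis.OperatorTheory.GaussianTransferKernel.inner_self_apply_eq_sum_eigenvalues
    (isSymmetric_smul_stiffHessian (L := L) (β / 2)) finrank_euclideanSpace (flatVec L β p)
  rw [h]
  change ∑ j, eigVal L β j * ⟪eigVec L β j, flatVec L β p⟫ ^ 2 = _
  rw [← Fintype.sum_subtype_add_sum_subtype (fun j : Fin (Fintype.card (Edge 3 L × Fin 3)) => eigVal L β j ≠ 0)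
    (fun j => eigVal L β j * ⟪eigVec L β j, flatVec L β p⟫ ^ 2)]
  have hzero : ∑ j : {j : Fin (Fintype.card (Edge 3 L × Fin 3)) // ¬eigVal L β j ≠ 0}, eigVal L β j.1 * ⟪eigVec L β j.1, flatVec L β p⟫ ^ 2 = 0 :=
    Finset.sum_eq_zero fun j _ => by rw [not_not.1 j.2, zero_mul]
  rw [hzero, add_zero]
  refine Finset.sum_congr rfl fun i _ => ?_
  rw [inner_eigVec_flatVec β p i]; unfold flatA; ring

/-! ## §4 Balancedness and the range -/

/-- `flatVec β p ⊥ constModes`. [folklore] -/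
theorem inner_constModes_flatVec (β : ℝ) (p : (StiffIdx L β → ℝ) × gaugeModes L) {c : LinkSpace L} (hc : c ∈ constModes L) :
    ⟪c, flatVec L β p⟫ = 0 := by
  rw [flatVec_apply, inner_add_right, inner_eq_zero_of_mem_constModes_of_mem_gaugeModes hc p.2.2, add_zero]
  exact inner_eq_zero_of_mem_constModes_of_mem_stiff hc (stiffPart_mem_stiffSpace (L := L) β p.1)

/-- `linkEmbed (flatMap β p) = flatVec β p` (and `linkEmbed = chartVec`). [folklore] -/
theorem linkEmbed_flatMap (β : ℝ) (p : (StiffIdx L β → ℝ) × gaugeModes L) : linkEmbed L (flatMap L β p) = flatVec L β p := by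
  change chartVec (linkCurry (flatVec L β p)) = flatVec L β p
  exact chartVec_linkCurry L (flatVec L β p)

/-- ★★ `flatMap β p ∈ balancedSet L`. [folklore] -/
theorem flatMap_mem_balancedSet (β : ℝ) (p : (StiffIdx L β → ℝ) × gaugeModes L) : flatMap L β p ∈ balancedSet L := by
  rw [mem_balancedSet]
  intro k a
  have h := inner_constModes_flatVec (L := L) β p (indicator_mem_constModes (L := L) k a)
  rw [inner_indicator_eq_sum_dir] at h
  simpa [flatMap, linkCurry] using h

/-- `flatMap β` is injective (`β > 0`). [folklore] -/
theorem flatMap_injective {β : ℝ} (hβ : 0 < β) : Function.Injective (flatMap L β) := fun p q h => by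
  have h' : linkEmbed L (flatMap L β p) = linkEmbed L (flatMap L β q) := by rw [h]
  rw [linkEmbed_flatMap, linkEmbed_flatMap] at h'
  exact flatVec_injective (L := L) hβ h'

/-- The zero-mode part of a balanced vector is its gauge projection. [folklore] -/
theorem zeroPart_eq_starProjection {v : LinkSpace L} (hv : ∀ c ∈ constModes L, ⟪c, v⟫ = 0) {w₀ s : LinkSpace L}
    (hw₀ : w₀ ∈ constModes L ⊔ gaugeModes L) (hs : s ∈ stiffSpace L) (hsum : s + w₀ = v) : (gaugeModes L).starProjection v = w₀ := by
  -- `w₀ ⊥ const` and `w₀ ∈ const ⊔ gauge` with `const ⊥ gauge` ⇒ `w₀ ∈ gauge`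
  obtain ⟨c, hc, g, hg, hcg⟩ := Submodule.mem_sup.1 hw₀
  have hsc : ⟪c, s⟫ = 0 := inner_eq_zero_of_mem_constModes_of_mem_stiff hc hs
  have hcg0 : ⟪c, g⟫ = 0 := inner_eq_zero_of_mem_constModes_of_mem_gaugeModes hc hg
  have hcv : ⟪c, v⟫ = 0 := hv c hc
  have hcc : ⟪c, c⟫ = 0 := by
    have : ⟪c, v⟫ = ⟪c, s⟫ + ⟪c, c⟫ + ⟪c, g⟫ := by rw [← hsum, ← hcg, inner_add_right, inner_add_right]; ring
    rw [hcv, hsc, hcg0] at this; linarith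
  have hc0 : c = 0 := inner_self_eq_zero.1 hcc
  rw [hc0, zero_add] at hcg
  have hw₀g : w₀ ∈ gaugeModes L := hcg ▸ hg
  refine Submodule.eq_starProjection_of_mem_orthogonal hw₀g ?_
  have : v - w₀ = s := by rw [← hsum]; abel
  rw [this]
  have hs' := hs
  rw [stiffSpace_eq_orthogonal] at hs'
  exact Submodule.orthogonal_le le_sup_right hs'

/-- ★★ **The flat parametrisation covers the balanced fibre**: `Set.range (flatMap β) = balancedSet L` (`β > 0`). [folklore] -/
theorem range_flatMap {β : ℝ} (hβ : 0 < β) : Set.range (flatMap L β) = balancedSet L := by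
  classical
  refine Set.Subset.antisymm (by rintro _ ⟨p, rfl⟩; exact flatMap_mem_balancedSet β p) fun v hv => ?_
  set w : LinkSpace L := linkEmbed L v with hw
  have hvc : ∀ c ∈ constModes L, ⟪c, w⟫ = 0 := fun c hc => inner_constMode_linkEmbed_eq_zero hc hv
  -- coordinates
  set y : StiffIdx L β → ℝ := fun i => ⟪eigVec L β i.1, w⟫ / flatScale L β i with hy
  have hPw : (gaugeModes L).starProjection w ∈ gaugeModes L := Submodule.starProjection_apply_mem _ _
  refine ⟨(y, ⟨(gaugeModes L).starProjection w, hPw⟩), ?_⟩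
  -- the stiff and zero-mode parts of `w`
  set s : LinkSpace L := ∑ i : StiffIdx L β, (flatScale L β i * y i) • eigVec L β i.1 with hsdef
  have hsi : ∀ i : StiffIdx L β, flatScale L β i * y i = ⟪eigVec L β i.1, w⟫ := fun i => by
    rw [hy]; field_simp [(flatScale_pos_sq (L := L) hβ i).1.ne']
  have hs_eq : s = ∑ i : StiffIdx L β, ⟪eigVec L β i.1, w⟫ • eigVec L β i.1 := Finset.sum_congr rfl fun i _ => by rw [hsi]
  set w₀ : LinkSpace L := ∑ j : {j : Fin (Fintype.card (Edge 3 L × Fin 3)) // ¬eigVal L β j ≠ 0}, ⟪eigVec L β j.1, w⟫ • eigVec L β j.1 with hw₀def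
  have hrepr : s + w₀ = w := by
    rw [hs_eq, hw₀def]
    have h : ∑ j, ⟪eigVec L β j, w⟫ • eigVec L β j = w :=
      ((isSymmetric_smul_stiffHessian (L := L) (β / 2)).eigenvectorBasis finrank_euclideanSpace).sum_repr' w
    rw [← Fintype.sum_subtype_add_sum_subtype (fun j : Fin (Fintype.card (Edge 3 L × Fin 3)) => eigVal L β j ≠ 0)
      (fun j => ⟪eigVec L β j, w⟫ • eigVec L β j)] at h
    exact h
  have hw₀ : w₀ ∈ constModes L ⊔ gaugeModes L :=
    Submodule.sum_mem _ fun j _ => Submodule.smul_mem _ _ (eigVec_mem_sup_of_eigVal_eq_zero (L := L) hβ.ne' (not_not.1 j.2))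
  have hs : s ∈ stiffSpace L := stiffPart_mem_stiffSpace (L := L) β y
  have hP : (gaugeModes L).starProjection w = w₀ := zeroPart_eq_starProjection (L := L) hvc hw₀ hs hrepr
  -- assemble
  have hflat : flatVec L β (y, ⟨(gaugeModes L).starProjection w, hPw⟩) = w := by
    rw [flatVec_apply]; change s + (gaugeModes L).starProjection w = w; rw [hP, hrepr]
  change linkCurry (flatVec L β (y, ⟨(gaugeModes L).starProjection w, hPw⟩)) = v
  rw [hflat, hw]
  exact linkCurry_chartVec L v

end Summit.QuantumFields.YangMills.Theorems.FemtoTransferGap.TwoLattice.ConstTube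

end
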